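import Literature.Probability.RandomPlanarGeometry.SAWLoopErasureMemoryTwoThreshold
import Literature.Probability.RandomPlanarGeometry.SAWLoopErasureMemoryTwoAxisSymmetry
import HarnessLib

/-!
# The (2̃,2) geometry of Hara–Slade–Sokal: the two-site taboo chain `A = {e_t, e_t + e_{t'}}`, its six loop
geometries, and the identities (3.13), (3.18) for it (`d ≥ 3`, `0 ≤ β ≤ 1/(2d−1)`)

Topic `Literature/Probability/RandomPlanarGeometry` (Hara–Slade–Sokal loop-erasure lane; the input side of
row (2̃,2) of HSS93 Table 2).  In the loop bound (2.36)–(2.39) with memory `τ = 2` and `k = 2` the taboo set is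
"the range of a 1-step self-avoiding walk starting at a nearest neighbour of the origin",
`A = {e_t, e_t + e_{t'}}` with `t' ≠ −t`, and the penalised direction is any `e_s ∉ A`, i.e. `s ≠ t`
(`stepVec_mem_twoChain_iff`: a unit vector is never a sum of two).  This module records, for that `A`:

* §1 `nbwAvoidTo_eq_empty_of_mem` / `tabooGF_eq_zero_of_mem` (no walk ends on the obstacle) and
  **`hss_tabooGF_insert_filter`** — (3.13) for a general obstacle `A` and taboo site `b ∉ A`, `b ≠ 0`, WITHOUT
  the side condition `b − e_g ∉ A` of the tree's `hss_tabooGF_insert`: the directions `g` with `b − e_g ∈ A`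
  simply drop out of the sum, their unknown `C^{A∪{b}}₂(0, b − e_g)` being `0` (`hss_tabooGF_insert_all`: the
  same with the plain sum over all `2d` directions, the vanishing terms kept);
  `tabooGF_singletonAt_eq` — (3.13) with `A = ∅` and ANY taboo site `b ≠ 0` (the tree's `tabooGF_singleton_eq`
  is `b = e_t`): the system for the one-point taboo functions `C^{{b}}₂(0,·;β)` with `|b|₁ = 2` that (3.13) for
  the chain calls for;
* §2 the chain `{e_t, e_t + e_{t'}}`: `0 ∉ A` (`zero_notMem_twoChain`), `e_s ∈ A ↔ s = t`, and
  **`hss318_twoChain`** — (3.18): `(1−β²)·C̃^{A;e_s}₂(0,0;β) = C^A₂(0,0;β) − β·C^A₂(0,e_s;β)`;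
* §3 **`hss313_twoChain`** — (3.13) with obstacle `{e_t}` and `b = e_t + e_{t'}`:
  `(1−β²)·C^{{e_t}}₂(0,x) = (1−β²)·C^A₂(0,x) + β Σ_g C^A₂(0, e_t+e_{t'}−e_g)·[C^{{−e_{t'}}}₂(0, x−b) −
  β·C^{{e_g−e_{t'}}}₂(0, x−b+e_g)]` (`b = e_t + e_{t'}`; the `g = t'` term is `0`, `tabooGF_twoChain_sub_snd`) —
  AS PRINTED "(3.13) provides a system of `2d` linear equations for `2d` unknowns, namely
  `{C^{A∪{b}}₂(y,b+f;β)}_{|f|=1}`": here `2d − 1` unknowns `C^A₂(0, b − e_g)`, `g ≠ t'`, with coefficients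
  one-point taboo functions whose taboo point is the neighbour `−e_{t'}` or a site `e_g − e_{t'}` with `|·|₁ = 2`;
* §4 the hyperoctahedral symmetry (`SAWLoopErasureMemoryTwoAxisSymmetry`) transports the chain
  (`image_twoChain_signedPerm`, `card_closedNbwPen_twoChain_stepPerm`, `card_nbwAvoidTo_twoChain_stepPerm`), so
  the loop counts `#closedNbwPen {e_t, e_t+e_{t'}} s n` take SIX values: STRAIGHT chain (`t' = t`) with
  `s = −t` or `s ⊥ t`, BENT chain (`t' ⊥ t`) with `s = −t`, `s = t'`, `s = −t'` or `s ⊥ t, t'`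
  (`card_closedNbwPen_straightChain_srev_eq`, `…_perp_eq`, `card_closedNbwPen_bentChain_srev_eq`, `…_fwd_eq`,
  `…_back_eq`, `…_perp_eq`; the case split `twoChain_cases`);
* §5 **`forall_twoChain_sum_le_of_six`** / **`forall_twoChain_sum_le_of_six_penGF`** — a bound `W` on the six
  representative penalised loop series (partial sums, resp. the sums `penGF`) is a bound for EVERY admissible
  `(t, t', s)`: the hypothesis of the `k = 2` loop-erasure engine in exactly its quantifier shape
  (`∀ t t' s, t' ≠ −t → s ≠ t → ∀ K, Σ_{j≤K} #closedNbwPen {e_t, e_t+e_{t'}} s j βʲ ≤ W`);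
* §6 by the same symmetry the unknowns of (3.13) collapse (`tabooGF_straightChain_sub_perp_eq`,
  `tabooGF_bentChain_sub_perp_eq`) and the sum splits: STRAIGHT chain — two unknowns `C^A₂(0,3e_t)`,
  `C^A₂(0,2e_t−e_u)` (`sum_dir_tabooGF_straightChain_mul_eq`); BENT chain `{e_t, e_t+e_u}` — four unknowns
  `C^A₂(0,e_u)`, `C^A₂(0,2e_t+e_u)`, `C^A₂(0,e_t+2e_u)`, `C^A₂(0,e_t+e_u−e_r)` (`sum_dir_tabooGF_bentChain_mul_eq`) —
  AS PRINTED "In practice, the number of unknowns is often reduced by symmetry".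

All statements are `d`-generic; no Green-function value is used here (the threshold specialisation
`C^∅₂ = ρ_d G` is the tree's `nbwGen_threshold_eq`, applied downstream as in `SAWLoopErasureMemoryTwoTildeOneSystem`).

References: [HSS93] T. Hara, G. Slade, A. D. Sokal, J. Stat. Phys. 72 (1993) 479–517, arXiv:hep-lat/9302003,
§2.4 eq. (2.36)–(2.39) pp. 10–11 (with footnote 2), §3.2 eq. (3.10)–(3.14) pp. 17–18, §3.3 eq. (3.18) p. 19,
§4.1 p. 26, Table 2 p. 12 (rows (2̃,2)).
-/

noncomputable section

namespace Literature.Probability.RandomPlanarGeometry.SAW.Zd.LoopErasure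

open Finset
open scoped BigOperators
open Literature.Probability.LatticeModels Literature.Probability.LatticeModels.SRW
open Literature.Probability.Percolation (IsNBW srev srev_srev srev_ne_self)
open Literature.Probability.FitznerVanDerHofstad2017 (stepPerm stepPerm_apply signedPerm_stepVec nbwGen)

variable {d : ℕ}

/-! ### §1 No walk ends on the obstacle; (3.13) without the side condition; (3.13) for any single taboo site -/

/-- A constrained walk cannot end on the obstacle: `nbwAvoidTo A x n = ∅` for `x ∈ A` (the position at time `n`
is the end point). [cite: HaraSladeSokal1993, §3.2 eq. (3.10) p. 17 (lane plumbing)] -/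
theorem nbwAvoidTo_eq_empty_of_mem {A : Finset (Site d)} {x : Site d} (hx : x ∈ A) (n : ℕ) :
    nbwAvoidTo A x n = ∅ := by
  refine Finset.eq_empty_of_forall_notMem fun ω hω => ?_
  rw [mem_nbwAvoidTo] at hω
  refine hω.1.2 n le_rfl ?_
  rw [pos_eq_endpoint, hω.2]
  exact hx

/-- `C^A₂(0,x;β) = 0` for `x ∈ A`: in (3.13) the unknowns `C^{A∪{b}}₂(0, b − e_g)` with `b − e_g ∈ A` vanish.
[cite: HaraSladeSokal1993, §3.2 eq. (3.10), (3.13) pp. 17–18 (lane plumbing)] -/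
theorem tabooGF_eq_zero_of_mem {A : Finset (Site d)} {x : Site d} (hx : x ∈ A) (β : ℝ) : tabooGF A x β = 0 := by
  simp [tabooGF, nbwAvoidTo_eq_empty_of_mem hx]

/-- `{a} − b = {a − b}`. [cite: HaraSladeSokal1993, §3.2 eq. (3.11)–(3.12) p. 18 (lane plumbing)] -/
theorem tabooShiftBy_singleton (a b : Site d) : tabooShiftBy ({a} : Finset (Site d)) b = {a - b} := by
  classical
  rw [tabooShiftBy, Finset.image_singleton]

/-- `{a} − e_f = {a − e_f}`. [cite: HaraSladeSokal1993, §3.2 eq. (3.11)–(3.12) p. 18 (lane plumbing)] -/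
theorem tabooShift_singleton (a : Site d) (f : Dir d) : tabooShift ({a} : Finset (Site d)) f = {a - stepVec f} := by
  classical
  rw [tabooShift, Finset.image_singleton]

/-- **Hara–Slade–Sokal (3.13), all directions:** for `0 ≤ β ≤ 1/(2d−1)`, `d ≥ 3`, `b ≠ 0`, `b ∉ A`,
`(1−β²)·C^A₂(0,x;β) = (1−β²)·C^{A∪{b}}₂(0,x;β)
  + β Σ_{g : b−e_g ∉ A} C^{A∪{b}}₂(0,b−e_g;β)·[C^{A−b}₂(0,x−b;β) − β C^{A−b+e_g}₂(0,x−b+e_g;β)]`: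
the tree's `hss_tabooGF_insert` assumes `b − e_g ∉ A` for every `g`; in general the directions with
`b − e_g ∈ A` contribute nothing, since then `C^{A∪{b}}₂(0, b−e_g;β) = 0` (`tabooGF_eq_zero_of_mem`).
[cite: HaraSladeSokal1993, §3.2 eq. (3.13) p. 18] -/
theorem hss_tabooGF_insert_filter (hd : 3 ≤ d) {A : Finset (Site d)} {b : Site d} (hb0 : b ≠ 0) (hbA : b ∉ A)
    (x : Site d) {β : ℝ} (hβ : 0 ≤ β) (hβc : β ≤ 1 / (2 * d - 1)) :
    (1 - β ^ 2) * tabooGF A x β = (1 - β ^ 2) * tabooGF (insert b A) x β +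
      β * ∑ g ∈ univ.filter (fun g : Dir d => b - stepVec g ∉ A), tabooGF (insert b A) (b - stepVec g) β *
        (tabooGF (tabooShiftBy A b) (x - b) β -
          β * tabooGF (tabooShift (tabooShiftBy A b) (srev g)) (x - b - stepVec (srev g)) β) := by
  classical
  have h0' : (0 : Site d) ∉ tabooShiftBy A b := by rwa [zero_mem_tabooShiftBy_iff]
  have h := tabooGF_eq_insert_add hd hb0 hbA x hβ hβc
  have hdrop : ∑ g : Dir d, tabooGF (insert b A) (b - stepVec g) β *
      tabooFirstGF (tabooShiftBy A b) (x - b) (srev g) β =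
      ∑ g ∈ univ.filter (fun g : Dir d => b - stepVec g ∉ A), tabooGF (insert b A) (b - stepVec g) β *
        tabooFirstGF (tabooShiftBy A b) (x - b) (srev g) β := by
    rw [Finset.sum_filter]
    refine Finset.sum_congr rfl fun g _ => ?_
    split_ifs with hg
    · rw [tabooGF_eq_zero_of_mem (Finset.mem_insert_of_mem hg), zero_mul]
    · rfl
  have hN : ∀ g ∈ univ.filter (fun g : Dir d => b - stepVec g ∉ A),
      (1 - β ^ 2) * tabooFirstGF (tabooShiftBy A b) (x - b) (srev g) β =
      tabooGF (tabooShiftBy A b) (x - b) β -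
        β * tabooGF (tabooShift (tabooShiftBy A b) (srev g)) (x - b - stepVec (srev g)) β := fun g hg =>
    hss_tabooFirstGF_eq hd h0' (stepVec_srev_notMem_tabooShiftBy (mem_filter.1 hg).2) (x - b) hβ hβc
  rw [h, hdrop, mul_add, Finset.mul_sum, Finset.mul_sum, Finset.mul_sum]
  congr 1
  refine Finset.sum_congr rfl fun g hg => ?_
  rw [← hN g hg]
  ring

/-- **(3.13), all directions, plain sum:** the same identity with the sum over ALL `2d` directions — the
terms with `b − e_g ∈ A` are present but vanish (`C^{A∪{b}}₂(0,b−e_g;β) = 0`), whatever the bracket.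
[cite: HaraSladeSokal1993, §3.2 eq. (3.13) p. 18] -/
theorem hss_tabooGF_insert_all (hd : 3 ≤ d) {A : Finset (Site d)} {b : Site d} (hb0 : b ≠ 0) (hbA : b ∉ A)
    (x : Site d) {β : ℝ} (hβ : 0 ≤ β) (hβc : β ≤ 1 / (2 * d - 1)) :
    (1 - β ^ 2) * tabooGF A x β = (1 - β ^ 2) * tabooGF (insert b A) x β +
      β * ∑ g : Dir d, tabooGF (insert b A) (b - stepVec g) β *
        (tabooGF (tabooShiftBy A b) (x - b) β -
          β * tabooGF (tabooShift (tabooShiftBy A b) (srev g)) (x - b - stepVec (srev g)) β) := by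
  classical
  rw [hss_tabooGF_insert_filter hd hb0 hbA x hβ hβc, Finset.sum_filter_of_ne]
  intro g _ hne hmem
  exact hne (by rw [tabooGF_eq_zero_of_mem (Finset.mem_insert_of_mem hmem), zero_mul])

/-- **(3.13) with no obstacle and one taboo site `b ≠ 0`:** for `0 ≤ β ≤ 1/(2d−1)`, `d ≥ 3`,
`(1−β²)·B_β(x) = (1−β²)·C^{{b}}₂(0,x;β) + β Σ_g C^{{b}}₂(0,b−e_g;β)·[B_β(x−b) − β·B_β(x−b+e_g)]`
(`B_β = nbwGen d β = C^∅₂`): the `2d × 2d` system for the one-point taboo function with taboo site `b` — for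
`b = e_t` the tree's `tabooGF_singleton_eq`; (3.13) for the chain `{e_t, e_t+e_{t'}}` (`hss313_twoChain`) needs it
for `b = −2e_{t'}` and `b = e_g − e_{t'}`, `g ⊥ t'`. [cite: HaraSladeSokal1993, §3.2 eq. (3.13) p. 18] -/
theorem tabooGF_singletonAt_eq (hd : 3 ≤ d) {b : Site d} (hb0 : b ≠ 0) (x : Site d) {β : ℝ} (hβ : 0 ≤ β)
    (hβc : β ≤ 1 / (2 * d - 1)) :
    (1 - β ^ 2) * nbwGen d β x = (1 - β ^ 2) * tabooGF {b} x β +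
      β * ∑ g : Dir d, tabooGF {b} (b - stepVec g) β *
        (nbwGen d β (x - b) - β * nbwGen d β (x - b + stepVec g)) := by
  have h := hss_tabooGF_insert hd hb0 (Finset.notMem_empty _) (fun g => Finset.notMem_empty _) x hβ hβc
  rw [tabooGF_empty_eq_nbwGen, Finset.insert_empty] at h
  rw [h]
  congr 1
  congr 1
  refine Finset.sum_congr rfl fun g _ => ?_
  rw [tabooShiftBy_empty, tabooShift_empty, tabooGF_empty_eq_nbwGen, tabooGF_empty_eq_nbwGen, stepVec_srev,
    sub_neg_eq_add]

/-! ### §2 The two-site chain `{e_t, e_t + e_{t'}}` and (3.18) for it -/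

/-- `e_t + e_{t'} ≠ 0` unless `t' = −t`. [cite: HaraSladeSokal1993, §2.4 eq. (2.36) p. 10 ("the range of a
(k−1)-step self-avoiding walk starting at a nearest neighbour of the origin")] -/
theorem stepVec_add_stepVec_ne_zero {t t' : Dir d} (h : t' ≠ srev t) : stepVec t + stepVec t' ≠ 0 := by
  intro h0
  apply h
  apply stepVec_injective
  rw [stepVec_srev, eq_neg_iff_add_eq_zero, add_comm]
  exact h0

/-- A unit vector is not a sum of two unit vectors: `e_s ≠ e_t + e_{t'}` (coordinate sums `±1` versus `0, ±2`).
[cite: HaraSladeSokal1993, §2.4 eq. (2.36) p. 10 ("nearest neighbors e of the origin satisfying e ∉ A")] -/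
theorem stepVec_ne_stepVec_add_stepVec (s t t' : Dir d) : stepVec s ≠ stepVec t + stepVec t' := by
  intro h
  have h1 := congrArg (fun x : Site d => ∑ j, x j) h
  simp only [Finset.sum_add_distrib, Pi.add_apply, sum_stepVec_apply] at h1
  obtain ⟨i, a⟩ := s
  obtain ⟨j, b⟩ := t
  obtain ⟨k, c⟩ := t'
  revert h1
  cases a <;> cases b <;> cases c <;> simp

/-- `0 ∉ {e_t, e_t + e_{t'}}` for `t' ≠ −t`. [cite: HaraSladeSokal1993, §2.4 eq. (2.36) p. 10; §3.3 eq. (3.18)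
p. 19 (0 ∉ A)] -/
theorem zero_notMem_twoChain {t t' : Dir d} (h : t' ≠ srev t) :
    (0 : Site d) ∉ ({stepVec t, stepVec t + stepVec t'} : Finset (Site d)) := by
  rw [Finset.mem_insert, Finset.mem_singleton, not_or]
  exact ⟨fun h0 => stepVec_ne_zero t h0.symm, fun h0 => stepVec_add_stepVec_ne_zero h h0.symm⟩

/-- `e_s ∈ {e_t, e_t + e_{t'}} ↔ s = t`: the admissible penalised directions of the chain are all `s ≠ t`.
[cite: HaraSladeSokal1993, §2.4 eq. (2.36) p. 10 ("nearest neighbors e of the origin satisfying e ∉ A")] -/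
theorem stepVec_mem_twoChain_iff {s t t' : Dir d} :
    stepVec s ∈ ({stepVec t, stepVec t + stepVec t'} : Finset (Site d)) ↔ s = t := by
  rw [Finset.mem_insert, Finset.mem_singleton, stepVec_injective.eq_iff,
    or_iff_left (stepVec_ne_stepVec_add_stepVec s t t')]

/-- **(3.18) for the chain:** `(1−β²)·C̃^{A;e_s}₂(0,0;β) = C^A₂(0,0;β) − β·C^A₂(0,e_s;β)`, `A = {e_t, e_t+e_{t'}}`,
`t' ≠ −t`, `s ≠ t`, `0 ≤ β ≤ 1/(2d−1)`, `d ≥ 3` — "hence the bound (2.39) can be computed once we know the values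
of `C^A₂(0,0;1/(2d−1))` and `C^A₂(0,e;1/(2d−1))`". [cite: HaraSladeSokal1993, §3.3 eq. (3.18) p. 19] -/
theorem hss318_twoChain (hd : 3 ≤ d) {t t' s : Dir d} (ht' : t' ≠ srev t) (hs : s ≠ t) {β : ℝ} (hβ : 0 ≤ β)
    (hβc : β ≤ 1 / (2 * d - 1)) :
    (1 - β ^ 2) * penGF {stepVec t, stepVec t + stepVec t'} s β =
      tabooGF {stepVec t, stepVec t + stepVec t'} 0 β -
        β * tabooGF {stepVec t, stepVec t + stepVec t'} (stepVec s) β :=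
  hss_penGF_eq hd (zero_notMem_twoChain ht') (fun h => hs (stepVec_mem_twoChain_iff.1 h)) hβ hβc

/-! ### §3 (3.13) for the chain: obstacle `{e_t}`, taboo site `b = e_t + e_{t'}` -/

/-- The unknown of the direction `g = t'` vanishes: `C^A₂(0, b − e_{t'}) = C^A₂(0, e_t) = 0` (`e_t ∈ A`).
[cite: HaraSladeSokal1993, §3.2 eq. (3.13) p. 18 (lane plumbing)] -/
theorem tabooGF_twoChain_sub_snd (t t' : Dir d) (β : ℝ) :
    tabooGF {stepVec t, stepVec t + stepVec t'} (stepVec t + stepVec t' - stepVec t') β = 0 := by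
  rw [add_sub_cancel_right]
  exact tabooGF_eq_zero_of_mem (Finset.mem_insert_self _ _) β

/-- **Hara–Slade–Sokal (3.13) for the two-site chain** (`A = {e_t, e_t + e_{t'}}`, `b = e_t + e_{t'}`, `t' ≠ −t`,
`0 ≤ β ≤ 1/(2d−1)`, `d ≥ 3`):
`(1−β²)·C^{{e_t}}₂(0,x;β) = (1−β²)·C^A₂(0,x;β)
  + β Σ_g C^A₂(0, b−e_g; β)·[C^{{−e_{t'}}}₂(0, x−b; β) − β·C^{{e_g−e_{t'}}}₂(0, x−b+e_g; β)]`
— AS PRINTED "`C^{A∪{b}}₂(y,x;β) = C^A₂(y,x;β) − (β/(1−β²)) Σ_f C^{A∪{b}}₂(y,b+f;β)[C^A₂(b,x;β) − βC^A₂(b+f,x;β)]`"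
with `y = 0`, `A = {e_t}`, `f = −g`, the bracket translated to start at the origin (`C^{{e_t}}₂(b,x) =
C^{{−e_{t'}}}₂(0,x−b)`, `C^{{e_t}}₂(b−e_g,x) = C^{{e_g−e_{t'}}}₂(0,x−b+e_g)`).  The term `g = t'` is zero
(`tabooGF_twoChain_sub_snd`: `b − e_{t'} = e_t ∈ A`); the `2d − 1` numbers `C^A₂(0, b−e_g;β)`, `g ≠ t'`, are the
unknowns; the one-point taboo functions in the bracket are those of the tree's `tabooGF_singleton_eq` (taboo
`−e_{t'}`, a neighbour of `0`) and of `tabooGF_singletonAt_eq` (taboo `e_g − e_{t'}`, `|·|₁ = 2`).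
[cite: HaraSladeSokal1993, §3.2 eq. (3.13) p. 18] -/
theorem hss313_twoChain (hd : 3 ≤ d) {t t' : Dir d} (ht' : t' ≠ srev t) (x : Site d) {β : ℝ} (hβ : 0 ≤ β)
    (hβc : β ≤ 1 / (2 * d - 1)) :
    (1 - β ^ 2) * tabooGF {stepVec t} x β =
      (1 - β ^ 2) * tabooGF {stepVec t, stepVec t + stepVec t'} x β +
        β * ∑ g : Dir d,
          tabooGF {stepVec t, stepVec t + stepVec t'} (stepVec t + stepVec t' - stepVec g) β *
            (tabooGF {-stepVec t'} (x - (stepVec t + stepVec t')) β -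
              β * tabooGF {stepVec g - stepVec t'} (x - (stepVec t + stepVec t') + stepVec g) β) := by
  classical
  have hb0 : stepVec t + stepVec t' ≠ 0 := stepVec_add_stepVec_ne_zero ht'
  have hbA : stepVec t + stepVec t' ∉ ({stepVec t} : Finset (Site d)) := by
    rw [Finset.mem_singleton, add_eq_left]
    exact stepVec_ne_zero t'
  rw [hss_tabooGF_insert_all hd hb0 hbA x hβ hβc, Finset.pair_comm (stepVec t + stepVec t') (stepVec t),
    tabooShiftBy_singleton, sub_add_cancel_left]
  congr 1
  congr 1
  refine Finset.sum_congr rfl fun g _ => ?_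
  rw [tabooShift_singleton, stepVec_srev, sub_neg_eq_add, sub_neg_eq_add, neg_add_eq_sub]

/-! ### §4 The chain under the hyperoctahedral group: six loop geometries -/

/-- `φ {e_t, e_t + e_{t'}} = {e_{σt}, e_{σt} + e_{σt'}}` for a signed coordinate permutation `φ` (`σ` its action on
directions). [cite: HaraSladeSokal1993, §3.2 p. 18 ("the number of unknowns is often reduced by symmetry")] -/
theorem image_twoChain_signedPerm (π : Equiv.Perm (Fin d)) (ε : Fin d → ℤˣ) (t t' : Dir d) :
    ({stepVec t, stepVec t + stepVec t'} : Finset (Site d)).image (Site.signedPerm π ε) =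
      {stepVec (stepPerm π ε t), stepVec (stepPerm π ε t) + stepVec (stepPerm π ε t')} := by
  classical
  simp only [image_insert, image_singleton, Site.signedPerm_add, signedPerm_srwStepVec]

/-- The penalised loop counts of the chain are `W_d`-invariant:
`#closedNbwPen {e_{σt}, e_{σt}+e_{σt'}} (σs) n = #closedNbwPen {e_t, e_t+e_{t'}} s n`.
[cite: HaraSladeSokal1993, §4.1 p. 26 ("which by symmetry are the only two geometries to be considered")] -/
theorem card_closedNbwPen_twoChain_stepPerm (π : Equiv.Perm (Fin d)) (ε : Fin d → ℤˣ) (t t' s : Dir d) (n : ℕ) :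
    (closedNbwPen {stepVec (stepPerm π ε t), stepVec (stepPerm π ε t) + stepVec (stepPerm π ε t')}
      (stepPerm π ε s) n).card = (closedNbwPen {stepVec t, stepVec t + stepVec t'} s n).card := by
  rw [← image_twoChain_signedPerm, card_closedNbwPen_signedPerm]

/-- The taboo counts of the chain are `W_d`-invariant:
`#nbwAvoidTo {e_{σt}, e_{σt}+e_{σt'}} (φx) n = #nbwAvoidTo {e_t, e_t+e_{t'}} x n`.
[cite: HaraSladeSokal1993, §3.2 p. 18 ("the number of unknowns is often reduced by symmetry")] -/
theorem card_nbwAvoidTo_twoChain_stepPerm (π : Equiv.Perm (Fin d)) (ε : Fin d → ℤˣ) (t t' : Dir d) (x : Site d)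
    (n : ℕ) :
    (nbwAvoidTo {stepVec (stepPerm π ε t), stepVec (stepPerm π ε t) + stepVec (stepPerm π ε t')}
      (Site.signedPerm π ε x) n).card = (nbwAvoidTo {stepVec t, stepVec t + stepVec t'} x n).card := by
  rw [← image_twoChain_signedPerm, card_nbwAvoidTo_signedPerm]

/-- STRAIGHT chain, straight penalty: `#closedNbwPen {e_t, 2e_t} (−t) n` does not depend on `t`.
[cite: HaraSladeSokal1993, §4.1 p. 26 (symmetry reduction of the loop geometries)] -/
theorem card_closedNbwPen_straightChain_srev_eq (t t₀ : Dir d) (n : ℕ) :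
    (closedNbwPen {stepVec t, stepVec t + stepVec t} (srev t) n).card =
      (closedNbwPen {stepVec t₀, stepVec t₀ + stepVec t₀} (srev t₀) n).card := by
  obtain ⟨π, ε, ht⟩ := exists_stepPerm_apply_eq t t₀
  rw [← card_closedNbwPen_twoChain_stepPerm π ε t t (srev t) n, stepPerm_srev, ht]

/-- STRAIGHT chain, bent penalty: `#closedNbwPen {e_t, 2e_t} s n` takes one value on all `s ⊥ t`.
[cite: HaraSladeSokal1993, §4.1 p. 26 (symmetry reduction of the loop geometries)] -/
theorem card_closedNbwPen_straightChain_perp_eq {t s t₀ s₀ : Dir d} (h : t.1 ≠ s.1) (h₀ : t₀.1 ≠ s₀.1) (n : ℕ) :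
    (closedNbwPen {stepVec t, stepVec t + stepVec t} s n).card =
      (closedNbwPen {stepVec t₀, stepVec t₀ + stepVec t₀} s₀ n).card := by
  obtain ⟨π, ε, ht, hs⟩ := exists_stepPerm_apply_eq_two h h₀
  rw [← card_closedNbwPen_twoChain_stepPerm π ε t t s n, ht, hs]

/-- BENT chain `{e_t, e_t+e_u}` (`u ⊥ t`), penalty `−t`: one value on all perpendicular pairs `(t,u)`.
[cite: HaraSladeSokal1993, §4.1 p. 26 (symmetry reduction of the loop geometries)] -/
theorem card_closedNbwPen_bentChain_srev_eq {t u t₀ u₀ : Dir d} (h : t.1 ≠ u.1) (h₀ : t₀.1 ≠ u₀.1) (n : ℕ) :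
    (closedNbwPen {stepVec t, stepVec t + stepVec u} (srev t) n).card =
      (closedNbwPen {stepVec t₀, stepVec t₀ + stepVec u₀} (srev t₀) n).card := by
  obtain ⟨π, ε, ht, hu⟩ := exists_stepPerm_apply_eq_two h h₀
  rw [← card_closedNbwPen_twoChain_stepPerm π ε t u (srev t) n, stepPerm_srev, ht, hu]

/-- BENT chain `{e_t, e_t+e_u}`, penalty `u` (forward along the second step): one value on all `(t,u)`.
[cite: HaraSladeSokal1993, §4.1 p. 26 (symmetry reduction of the loop geometries)] -/
theorem card_closedNbwPen_bentChain_fwd_eq {t u t₀ u₀ : Dir d} (h : t.1 ≠ u.1) (h₀ : t₀.1 ≠ u₀.1) (n : ℕ) :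
    (closedNbwPen {stepVec t, stepVec t + stepVec u} u n).card =
      (closedNbwPen {stepVec t₀, stepVec t₀ + stepVec u₀} u₀ n).card := by
  obtain ⟨π, ε, ht, hu⟩ := exists_stepPerm_apply_eq_two h h₀
  rw [← card_closedNbwPen_twoChain_stepPerm π ε t u u n, ht, hu]

/-- BENT chain `{e_t, e_t+e_u}`, penalty `−u`: one value on all `(t,u)`.
[cite: HaraSladeSokal1993, §4.1 p. 26 (symmetry reduction of the loop geometries)] -/
theorem card_closedNbwPen_bentChain_back_eq {t u t₀ u₀ : Dir d} (h : t.1 ≠ u.1) (h₀ : t₀.1 ≠ u₀.1) (n : ℕ) :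
    (closedNbwPen {stepVec t, stepVec t + stepVec u} (srev u) n).card =
      (closedNbwPen {stepVec t₀, stepVec t₀ + stepVec u₀} (srev u₀) n).card := by
  obtain ⟨π, ε, ht, hu⟩ := exists_stepPerm_apply_eq_two h h₀
  rw [← card_closedNbwPen_twoChain_stepPerm π ε t u (srev u) n, stepPerm_srev, ht, hu]

/-- BENT chain `{e_t, e_t+e_u}`, penalty `r ⊥ t, u`: one value on all pairwise perpendicular triples `(t,u,r)`.
[cite: HaraSladeSokal1993, §4.1 p. 26 (symmetry reduction of the loop geometries)] -/
theorem card_closedNbwPen_bentChain_perp_eq {t u r t₀ u₀ r₀ : Dir d} (htu : t.1 ≠ u.1) (htr : t.1 ≠ r.1)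
    (hur : u.1 ≠ r.1) (htu₀ : t₀.1 ≠ u₀.1) (htr₀ : t₀.1 ≠ r₀.1) (hur₀ : u₀.1 ≠ r₀.1) (n : ℕ) :
    (closedNbwPen {stepVec t, stepVec t + stepVec u} r n).card =
      (closedNbwPen {stepVec t₀, stepVec t₀ + stepVec u₀} r₀ n).card := by
  obtain ⟨π, ε, ht, hu, hr⟩ := exists_stepPerm_apply_eq_three htu htr hur htu₀ htr₀ hur₀
  rw [← card_closedNbwPen_twoChain_stepPerm π ε t u r n, ht, hu, hr]

/-- **The six geometries exhaust the admissible triples**: for `t' ≠ −t` and `s ≠ t`, either the chain is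
straight (`t' = t`) and `s = −t` or `s ⊥ t`, or it is bent (`t' ⊥ t`) and `s = −t`, `s = t'`, `s = −t'` or
`s ⊥ t, t'`. [cite: HaraSladeSokal1993, §4.1 p. 26 (symmetry reduction of the loop geometries); §2.4 eq. (2.36)
p. 10] -/
theorem twoChain_cases {t t' s : Dir d} (ht' : t' ≠ srev t) (hs : s ≠ t) :
    (t' = t ∧ s = srev t) ∨ (t' = t ∧ s.1 ≠ t.1) ∨ (t'.1 ≠ t.1 ∧ s = srev t) ∨ (t'.1 ≠ t.1 ∧ s = t') ∨
      (t'.1 ≠ t.1 ∧ s = srev t') ∨ (t'.1 ≠ t.1 ∧ s.1 ≠ t.1 ∧ s.1 ≠ t'.1) := by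
  by_cases h1 : t'.1 = t.1
  · have htt : t' = t := by
      rcases dir_fst_eq_iff.1 h1 with h | h
      · exact h
      · exact absurd h ht'
    by_cases h2 : s.1 = t.1
    · rcases dir_fst_eq_iff.1 h2 with h | h
      · exact absurd h hs
      · exact Or.inl ⟨htt, h⟩
    · exact Or.inr (Or.inl ⟨htt, h2⟩)
  · by_cases h2 : s.1 = t.1
    · rcases dir_fst_eq_iff.1 h2 with h | h
      · exact absurd h hs
      · exact Or.inr (Or.inr (Or.inl ⟨h1, h⟩))
    · by_cases h3 : s.1 = t'.1
      · rcases dir_fst_eq_iff.1 h3 with h | h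
        · exact Or.inr (Or.inr (Or.inr (Or.inl ⟨h1, h⟩)))
        · exact Or.inr (Or.inr (Or.inr (Or.inr (Or.inl ⟨h1, h⟩))))
      · exact Or.inr (Or.inr (Or.inr (Or.inr (Or.inr ⟨h1, h2, h3⟩))))

/-! ### §5 A bound on the six representative loop series bounds every admissible geometry -/

/-- **Six numbers suffice.**  Fix pairwise perpendicular directions `t₀, u₀, r₀` (`d ≥ 3`).  If `W` bounds the
partial sums `Σ_{j≤K} #closedNbwPen A s j · βʲ` of the penalised loop series for the six representative geometries
— `A = {e_{t₀}, 2e_{t₀}}` with `s = −t₀`, `s = u₀`; `A = {e_{t₀}, e_{t₀}+e_{u₀}}` with `s = −t₀`, `u₀`, `−u₀`, `r₀` —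
then it bounds them for EVERY chain `{e_t, e_t+e_{t'}}`, `t' ≠ −t`, and every `s ≠ t`: the hypothesis of the
`τ = 2`, `k = 2` loop-erasure engine. [cite: HaraSladeSokal1993, §2.4 eq. (2.36)–(2.39) pp. 10–11; §4.1 p. 26
(symmetry reduction of the loop geometries)] -/
theorem forall_twoChain_sum_le_of_six {t₀ u₀ r₀ : Dir d} (htu : t₀.1 ≠ u₀.1) (htr : t₀.1 ≠ r₀.1)
    (hur : u₀.1 ≠ r₀.1) {β W : ℝ}
    (h1 : ∀ K : ℕ, ∑ j ∈ range (K + 1),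
      ((closedNbwPen {stepVec t₀, stepVec t₀ + stepVec t₀} (srev t₀) j).card : ℝ) * β ^ j ≤ W)
    (h2 : ∀ K : ℕ, ∑ j ∈ range (K + 1),
      ((closedNbwPen {stepVec t₀, stepVec t₀ + stepVec t₀} u₀ j).card : ℝ) * β ^ j ≤ W)
    (h3 : ∀ K : ℕ, ∑ j ∈ range (K + 1),
      ((closedNbwPen {stepVec t₀, stepVec t₀ + stepVec u₀} (srev t₀) j).card : ℝ) * β ^ j ≤ W)
    (h4 : ∀ K : ℕ, ∑ j ∈ range (K + 1),
      ((closedNbwPen {stepVec t₀, stepVec t₀ + stepVec u₀} u₀ j).card : ℝ) * β ^ j ≤ W)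
    (h5 : ∀ K : ℕ, ∑ j ∈ range (K + 1),
      ((closedNbwPen {stepVec t₀, stepVec t₀ + stepVec u₀} (srev u₀) j).card : ℝ) * β ^ j ≤ W)
    (h6 : ∀ K : ℕ, ∑ j ∈ range (K + 1),
      ((closedNbwPen {stepVec t₀, stepVec t₀ + stepVec u₀} r₀ j).card : ℝ) * β ^ j ≤ W) :
    ∀ t t' s : Dir d, t' ≠ srev t → s ≠ t → ∀ K : ℕ,
      ∑ j ∈ range (K + 1), ((closedNbwPen {stepVec t, stepVec t + stepVec t'} s j).card : ℝ) * β ^ j ≤ W := by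
  intro t t' s ht' hs K
  rcases twoChain_cases ht' hs with ⟨rfl, rfl⟩ | ⟨rfl, h⟩ | ⟨h, rfl⟩ | ⟨h, rfl⟩ | ⟨h, rfl⟩ | ⟨h, h', h''⟩
  · simp only [card_closedNbwPen_straightChain_srev_eq t' t₀]
    exact h1 K
  · simp only [card_closedNbwPen_straightChain_perp_eq h.symm htu]
    exact h2 K
  · simp only [card_closedNbwPen_bentChain_srev_eq h.symm htu]
    exact h3 K
  · simp only [card_closedNbwPen_bentChain_fwd_eq h.symm htu]
    exact h4 K
  · simp only [card_closedNbwPen_bentChain_back_eq h.symm htu]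
    exact h5 K
  · simp only [card_closedNbwPen_bentChain_perp_eq h.symm h'.symm h''.symm htu htr hur]
    exact h6 K

/-- **Six series suffice** (`0 ≤ β ≤ 1/(2d−1)`, `d ≥ 3`): if `W` bounds the six representative penalised loop
generating functions `C̃^{A;e_s}₂(0,0;β)` (`penGF`) — straight chain `{e_{t₀}, 2e_{t₀}}` with `s = −t₀`, `u₀`; bent
chain `{e_{t₀}, e_{t₀}+e_{u₀}}` with `s = −t₀`, `u₀`, `−u₀`, `r₀` — then it bounds every partial sum of every admissible
geometry `({e_t, e_t+e_{t'}}, e_s)`, `t' ≠ −t`, `s ≠ t`. [cite: HaraSladeSokal1993, §2.4 eq. (2.36)–(2.39)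
pp. 10–11; §3.3 eq. (3.18) p. 19; §4.1 p. 26] -/
theorem forall_twoChain_sum_le_of_six_penGF (hd : 3 ≤ d) {t₀ u₀ r₀ : Dir d} (htu : t₀.1 ≠ u₀.1)
    (htr : t₀.1 ≠ r₀.1) (hur : u₀.1 ≠ r₀.1) {β W : ℝ} (hβ : 0 ≤ β) (hβc : β ≤ 1 / (2 * d - 1))
    (h1 : penGF {stepVec t₀, stepVec t₀ + stepVec t₀} (srev t₀) β ≤ W)
    (h2 : penGF {stepVec t₀, stepVec t₀ + stepVec t₀} u₀ β ≤ W)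
    (h3 : penGF {stepVec t₀, stepVec t₀ + stepVec u₀} (srev t₀) β ≤ W)
    (h4 : penGF {stepVec t₀, stepVec t₀ + stepVec u₀} u₀ β ≤ W)
    (h5 : penGF {stepVec t₀, stepVec t₀ + stepVec u₀} (srev u₀) β ≤ W)
    (h6 : penGF {stepVec t₀, stepVec t₀ + stepVec u₀} r₀ β ≤ W) :
    ∀ t t' s : Dir d, t' ≠ srev t → s ≠ t → ∀ K : ℕ,
      ∑ j ∈ range (K + 1), ((closedNbwPen {stepVec t, stepVec t + stepVec t'} s j).card : ℝ) * β ^ j ≤ W :=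
  forall_twoChain_sum_le_of_six htu htr hur
    (fun K => (sum_range_card_closedNbwPen_le_penGF hd _ _ hβ hβc (K + 1)).trans h1)
    (fun K => (sum_range_card_closedNbwPen_le_penGF hd _ _ hβ hβc (K + 1)).trans h2)
    (fun K => (sum_range_card_closedNbwPen_le_penGF hd _ _ hβ hβc (K + 1)).trans h3)
    (fun K => (sum_range_card_closedNbwPen_le_penGF hd _ _ hβ hβc (K + 1)).trans h4)
    (fun K => (sum_range_card_closedNbwPen_le_penGF hd _ _ hβ hβc (K + 1)).trans h5)
    (fun K => (sum_range_card_closedNbwPen_le_penGF hd _ _ hβ hβc (K + 1)).trans h6)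

/-! ### §6 The unknowns of (3.13) for the chain collapse: two (straight chain) and four (bent chain) -/

/-- `b − e_g = b + e_{−g}`. [cite: HaraSladeSokal1993, §3.2 eq. (3.13) p. 18 (lane plumbing)] -/
theorem sub_stepVec_eq_add_stepVec_srev (b : Site d) (g : Dir d) : b - stepVec g = b + stepVec (srev g) := by
  rw [stepVec_srev, sub_eq_add_neg]

/-- STRAIGHT chain `{e_t, 2e_t}` (`b = 2e_t`): the perpendicular unknowns coincide — `C^A₂(0, 2e_t − e_g)` takes one
value on all `g ⊥ t` (so the unknowns are `C^A₂(0,3e_t)` and this one).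
[cite: HaraSladeSokal1993, §3.2 p. 18 ("the number of unknowns is often reduced by symmetry")] -/
theorem tabooGF_straightChain_sub_perp_eq {t g u : Dir d} (hg : g.1 ≠ t.1) (hu : u.1 ≠ t.1) (β : ℝ) :
    tabooGF {stepVec t, stepVec t + stepVec t} (stepVec t + stepVec t - stepVec g) β =
      tabooGF {stepVec t, stepVec t + stepVec t} (stepVec t + stepVec t - stepVec u) β := by
  have hg' : t.1 ≠ (srev g).1 := fun h => hg (by rw [srev] at h; exact h.symm)
  have hu' : t.1 ≠ (srev u).1 := fun h => hu (by rw [srev] at h; exact h.symm)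
  obtain ⟨π, ε, ht, hgu⟩ := exists_stepPerm_apply_eq_two hg' hu'
  refine tsum_congr fun n => ?_
  rw [sub_stepVec_eq_add_stepVec_srev, sub_stepVec_eq_add_stepVec_srev,
    ← card_nbwAvoidTo_twoChain_stepPerm π ε t t (stepVec t + stepVec t + stepVec (srev g)) n]
  simp only [Site.signedPerm_add, signedPerm_srwStepVec, ht, hgu]

/-- BENT chain `{e_t, e_t+e_u}` (`b = e_t + e_u`, `u ⊥ t`): the unknowns `C^A₂(0, b − e_g)` with `g ⊥ t, u` coincide
(so the unknowns are `C^A₂(0,e_u)`, `C^A₂(0,2e_t+e_u)`, `C^A₂(0,e_t+2e_u)` and this one).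
[cite: HaraSladeSokal1993, §3.2 p. 18 ("the number of unknowns is often reduced by symmetry"); Appendix B p. 32] -/
theorem tabooGF_bentChain_sub_perp_eq {t u g r : Dir d} (hut : u.1 ≠ t.1) (hgt : g.1 ≠ t.1) (hgu : g.1 ≠ u.1)
    (hrt : r.1 ≠ t.1) (hru : r.1 ≠ u.1) (β : ℝ) :
    tabooGF {stepVec t, stepVec t + stepVec u} (stepVec t + stepVec u - stepVec g) β =
      tabooGF {stepVec t, stepVec t + stepVec u} (stepVec t + stepVec u - stepVec r) β := by
  have hgt' : t.1 ≠ (srev g).1 := fun h => hgt (by rw [srev] at h; exact h.symm)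
  have hgu' : u.1 ≠ (srev g).1 := fun h => hgu (by rw [srev] at h; exact h.symm)
  have hrt' : t.1 ≠ (srev r).1 := fun h => hrt (by rw [srev] at h; exact h.symm)
  have hru' : u.1 ≠ (srev r).1 := fun h => hru (by rw [srev] at h; exact h.symm)
  obtain ⟨π, ε, ht, hu, hgr⟩ := exists_stepPerm_apply_eq_three hut.symm hgt' hgu' hut.symm hrt' hru'
  refine tsum_congr fun n => ?_
  rw [sub_stepVec_eq_add_stepVec_srev, sub_stepVec_eq_add_stepVec_srev,
    ← card_nbwAvoidTo_twoChain_stepPerm π ε t u (stepVec t + stepVec u + stepVec (srev g)) n]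
  simp only [Site.signedPerm_add, signedPerm_srwStepVec, ht, hu, hgr]

/-- **STRAIGHT chain, collapse of the sum in (3.13)**: for any weights `Φ` (`u ⊥ t` fixed),
`Σ_g C^A₂(0,2e_t−e_g)Φ(g) = C^A₂(0,3e_t)Φ(−t) + C^A₂(0,2e_t−e_u)·Σ_{g⊥t}Φ(g)` (`A = {e_t, 2e_t}`; the `g = t` term is
`C^A₂(0,e_t) = 0`). [cite: HaraSladeSokal1993, §3.2 p. 18 ("we can first solve the system of three equations in three
unknowns")] -/
theorem sum_dir_tabooGF_straightChain_mul_eq {t u : Dir d} (hut : u.1 ≠ t.1) (β : ℝ) (Φ : Dir d → ℝ) :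
    ∑ g : Dir d, tabooGF {stepVec t, stepVec t + stepVec t} (stepVec t + stepVec t - stepVec g) β * Φ g =
      tabooGF {stepVec t, stepVec t + stepVec t} (stepVec t + stepVec t - stepVec (srev t)) β * Φ (srev t) +
        tabooGF {stepVec t, stepVec t + stepVec t} (stepVec t + stepVec t - stepVec u) β *
          ∑ g ∈ univ.filter (fun g : Dir d => g.1 ≠ t.1), Φ g := by
  rw [sum_dir_eq_add_add_sum_filter _ t, tabooGF_twoChain_sub_snd, zero_mul, zero_add, mul_sum]
  congr 1
  refine sum_congr rfl fun g hg => ?_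
  rw [tabooGF_straightChain_sub_perp_eq (mem_filter.1 hg).2 hut]

/-- **BENT chain, collapse of the sum in (3.13)**: for any weights `Φ` (`u ⊥ t`, `r ⊥ t, u` fixed; `b = e_t + e_u`),
`Σ_g C^A₂(0,b−e_g)Φ(g) = C^A₂(0,e_u)Φ(t) + C^A₂(0,2e_t+e_u)Φ(−t) + C^A₂(0,e_t+2e_u)Φ(−u) + C^A₂(0,b−e_r)·Σ_{g⊥t,u}Φ(g)`
(`A = {e_t, e_t+e_u}`; the `g = u` term is `C^A₂(0,e_t) = 0`). [cite: HaraSladeSokal1993, §3.2 p. 18 ("the number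
of unknowns is often reduced by symmetry"); Appendix B p. 32] -/
theorem sum_dir_tabooGF_bentChain_mul_eq {t u r : Dir d} (hut : u.1 ≠ t.1) (hrt : r.1 ≠ t.1) (hru : r.1 ≠ u.1)
    (β : ℝ) (Φ : Dir d → ℝ) :
    ∑ g : Dir d, tabooGF {stepVec t, stepVec t + stepVec u} (stepVec t + stepVec u - stepVec g) β * Φ g =
      tabooGF {stepVec t, stepVec t + stepVec u} (stepVec t + stepVec u - stepVec t) β * Φ t +
        tabooGF {stepVec t, stepVec t + stepVec u} (stepVec t + stepVec u - stepVec (srev t)) β * Φ (srev t) +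
        tabooGF {stepVec t, stepVec t + stepVec u} (stepVec t + stepVec u - stepVec (srev u)) β * Φ (srev u) +
        tabooGF {stepVec t, stepVec t + stepVec u} (stepVec t + stepVec u - stepVec r) β *
          ∑ g ∈ univ.filter (fun g : Dir d => g.1 ≠ t.1 ∧ g.1 ≠ u.1), Φ g := by
  rw [sum_dir_eq_add_add_sum_filter _ t, sum_filter_fst_ne_eq _ hut, tabooGF_twoChain_sub_snd, zero_mul, zero_add,
    mul_sum, ← add_assoc]
  congr 1
  refine sum_congr rfl fun g hg => ?_
  rw [tabooGF_bentChain_sub_perp_eq hut (mem_filter.1 hg).2.1 (mem_filter.1 hg).2.2 hrt hru]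

end Literature.Probability.RandomPlanarGeometry.SAW.Zd.LoopErasure

end
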